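import Mathlib
import Summits.KontsevichZagierPeriods.KontsevichZagierPeriods.Theorems.SoloInformedSecondKindIsogeny
import HarnessLib
import HarnessLib.Audit

/-!
# W35: `2·⟦β(⅚,½)⟧ = ⟦[pt,√3]⟧·⟦β(⅔,½)⟧` by the second-kind isogeny move (solo-informed, s24) — THEOREM XIII‴

Assembly of the second-kind companion of the `3`-isogeny `ψ(t) = 27t²/(4−t)³`
(`SoloInformedSecondKindIsogeny`: the change of variables `[9√3 · S] ∼ β(⅚,½)` for the pulled-back
representation `S = [(0,1), t^{2/3}(1−t)^{−1/2}/(4−t)²]`, and the Newton–Leibniz reduction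
`S ∼ [(0,1), (1/18)·t^{−1/3}(1−t)^{−1/2}]` with the algebraic primitive `−⅓t^{2/3}(1−t)^{1/2}/(4−t)`):

* `⟦[pt, 9√3]⟧ · ⟦[pt, 1/18]⟧ · ⟦β(⅔,½)⟧ = ⟦β(⅚,½)⟧` (`soloInformed_secondKind_isogeny_chain`);
* **W35** `2 · ⟦β(⅚,½)⟧ = ⟦[pt, √3]⟧ · ⟦β(⅔,½)⟧` (`soloInformed_secondKind_W35`; point-field
  arithmetic `2 · 9√3 · (1/18) = √3` in `K ⊂ P`), value `2B(⅚,½) = √3·B(⅔,½)` (`_value`) — with the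
  reflection chains, `2x(3,5) = √3·x(3,4)`: the LAST level-6 cycle relation of `y² = x³ + 1`
  (paper §6octies (vi)), realised WITHOUT cancellation and without `π`;
* `⟦β(⅚,½)⟧` and `⟦β(⅚,⅚)⟧` lie in every `K`-hull containing `⟦β(⅔,½)⟧`
  (`soloInformed_betaFiveSixthsHalf_mem_algHull`, `soloInformed_betaFiveSixthsFiveSixths_mem_algHull`,
  the latter by the duplication move at `⅚`).

Together with W45, W25 (`SoloInformedSecondKindCycles`), every second-kind class of level 6 is tied
to `⟦β(⅔,½)⟧` by kernel-checked chains; the level-6 hull theorem is `SoloInformedLevelSixDecided`.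

References: M. Kontsevich, D. Zagier, *Periods* (2001), §1.2; G. Andrews, R. Askey, R. Roy,
*Special Functions* (1999), §1.1; this work (solo-informed s24).
-/

noncomputable section

open MeasureTheory Set Filter
open scoped Classical

open Literature.NumberTheory.Transcendental Literature.NumberTheory.Transcendental.KZ
open Literature.ModelTheory.ExponentialFields

namespace Summit.KontsevichZagierPeriods.KontsevichZagierPeriods.Theorems

/-! ### THEOREM XIII‴: the chain, W35, value, hull memberships -/

/-- **THEOREM XIII‴ (the second-kind isogeny chain).** For pinned `A = β(⅔,½)` and `B = β(⅚,½)`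
on `(0,1)`:  `⟦[pt, 9√3]⟧ · (⟦[pt, 1/18]⟧ · ⟦A⟧) = ⟦B⟧` in the formal period ring — one change
of variables along the `3`-isogeny, one additivity of integrands, one Newton–Leibniz move over
the point (with the null boundary); no cancellation, no `π`.  Value: `9√3·(1/18)·B(⅔,½) =
B(⅚,½)`. [this work] -/
theorem soloInformed_secondKind_isogeny_chain (hca : IsAlgebraic ℚ ((((1 / 18 : ℚ)) : ℝ)))
    (A B : IntegralRep 1)
    (hAd : A.domain = {t | t 0 ∈ Ioo (0:ℝ) 1})
    (hAi : EqOn A.integrand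
      (fun t => (t 0) ^ (((2 / 3 : ℚ) : ℝ) - 1) * (1 - t 0) ^ (((1 / 2 : ℚ) : ℝ) - 1)) A.domain)
    (hBd : B.domain = {t | t 0 ∈ Ioo (0:ℝ) 1})
    (hBi : EqOn B.integrand
      (fun t => (t 0) ^ (((5 / 6 : ℚ) : ℝ) - 1) * (1 - t 0) ^ (((1 / 2 : ℚ) : ℝ) - 1)) B.domain) :
    toFormalPeriod (of (IntegralRep.unit.constMul ((9:ℝ) * Real.sqrt 3)
        soloInformed_isAlgebraic_nine_sqrt_three)) *
      (toFormalPeriod (of (IntegralRep.unit.constMul ((((1 / 18 : ℚ)) : ℝ)) hca)) *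
        toFormalPeriod (of A)) = toFormalPeriod (of B) := by
  obtain ⟨S, hSd, hSi⟩ := soloInformed_exists_secondKindRep₃ (2 / 3) (1 / 2) (by norm_num)
    (by norm_num)
  have hcov := soloInformed_isogeny₂_mem_changeOfVariablesRel S B hSd (fun x _ => by rw [hSi])
    hBd hBi
  have hred : Equivalent S (A.constMul ((((1 / 18 : ℚ)) : ℝ)) hca) :=
    soloInformed_secondKind₃_reduction (2 / 3) (1 / 2) (1 / 18) (by norm_num) (by norm_num)
      (by norm_num) (by norm_num) S _ hSd (fun x _ => by rw [hSi])
      (by rw [IntegralRep.domain_constMul, hAd]) fun x hx => by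
        have hxA : x ∈ A.domain := by rw [IntegralRep.domain_constMul] at hx; exact hx
        simp only [IntegralRep.integrand_constMul]
        rw [hAi hxA]
  rw [← toFormalPeriod_of_constMul, ← hred.toFormalPeriod_eq, ← toFormalPeriod_of_constMul]
  exact toFormalPeriod_eq_iff.mpr (changeOfVariablesRel_subset_relations hcov)

/-- **W35.** For pinned `B₅₃ = β(⅚,½)` and `B₄₃ = β(⅔,½)`:
`2 · ⟦B₅₃⟧ = ⟦[pt, √3]⟧ · ⟦B₄₃⟧` in the formal period ring (`2 · 9√3 · (1/18) = √3` in the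
point field `K ⊂ P`).  With the reflection chains this is `2x(3,5) = √3·x(3,4)` of paper §6octies
(vi): the last of the level-6 cycle relations, realised WITHOUT cancellation. [this work] -/
theorem soloInformed_secondKind_W35 (B₅₃ B₄₃ : IntegralRep 1)
    (h53d : B₅₃.domain = {t | t 0 ∈ Ioo (0:ℝ) 1})
    (h53i : EqOn B₅₃.integrand
      (fun t => (t 0) ^ (((5 / 6 : ℚ) : ℝ) - 1) * (1 - t 0) ^ (((1 / 2 : ℚ) : ℝ) - 1)) B₅₃.domain)
    (h43d : B₄₃.domain = {t | t 0 ∈ Ioo (0:ℝ) 1})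
    (h43i : EqOn B₄₃.integrand
      (fun t => (t 0) ^ (((2 / 3 : ℚ) : ℝ) - 1) * (1 - t 0) ^ (((1 / 2 : ℚ) : ℝ) - 1)) B₄₃.domain) :
    2 * toFormalPeriod (of B₅₃) =
      toFormalPeriod (of (IntegralRep.unit.constMul (Real.sqrt 3)
        (soloInformed_isAlgebraic_sqrt_natCast 3))) * toFormalPeriod (of B₄₃) := by
  have hca : IsAlgebraic ℚ ((((1 / 18 : ℚ)) : ℝ)) := isAlgebraic_algebraMap (1 / 18 : ℚ)
  have h2 : IsAlgebraic ℚ (((2 : ℕ) : ℝ)) := isAlgebraic_nat 2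
  have hchain := soloInformed_secondKind_isogeny_chain hca B₄₃ B₅₃ h43d h43i h53d h53i
  -- point-field arithmetic: `⟦pt,2⟧ · ⟦pt,9√3⟧ · ⟦pt,1/18⟧ = ⟦pt,√3⟧`
  have hxc : IsAlgebraic ℚ ((9:ℝ) * Real.sqrt 3 * ((((1 / 18 : ℚ)) : ℝ))) :=
    soloInformed_isAlgebraic_nine_sqrt_three.mul hca
  have E2 := soloInformed_pointRep_mul _ _ soloInformed_isAlgebraic_nine_sqrt_three hca hxc
  have htxc : IsAlgebraic ℚ (((2 : ℕ) : ℝ) * ((9:ℝ) * Real.sqrt 3 * ((((1 / 18 : ℚ)) : ℝ)))) :=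
    h2.mul hxc
  have E4 := soloInformed_pointRep_mul _ _ h2 hxc htxc
  have E3 : toFormalPeriod (of (IntegralRep.unit.constMul (((2 : ℕ) : ℝ)) h2)) = 2 := by
    rw [soloInformed_pointRep_natCast]; norm_num
  have E5 : toFormalPeriod (of (IntegralRep.unit.constMul
      (((2 : ℕ) : ℝ) * ((9:ℝ) * Real.sqrt 3 * ((((1 / 18 : ℚ)) : ℝ)))) htxc)) =
      toFormalPeriod (of (IntegralRep.unit.constMul (Real.sqrt 3)
        (soloInformed_isAlgebraic_sqrt_natCast 3))) :=
    soloInformed_pointRep_congr htxc _ (by push_cast; ring)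
  calc 2 * toFormalPeriod (of B₅₃)
      = 2 * (toFormalPeriod (of (IntegralRep.unit.constMul ((9:ℝ) * Real.sqrt 3)
          soloInformed_isAlgebraic_nine_sqrt_three)) *
          (toFormalPeriod (of (IntegralRep.unit.constMul ((((1 / 18 : ℚ)) : ℝ)) hca)) *
            toFormalPeriod (of B₄₃))) := by rw [hchain]
    _ = toFormalPeriod (of (IntegralRep.unit.constMul (((2 : ℕ) : ℝ)) h2)) *
          (toFormalPeriod (of (IntegralRep.unit.constMul ((9:ℝ) * Real.sqrt 3)
            soloInformed_isAlgebraic_nine_sqrt_three)) *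
          toFormalPeriod (of (IntegralRep.unit.constMul ((((1 / 18 : ℚ)) : ℝ)) hca))) *
          toFormalPeriod (of B₄₃) := by rw [E3]; ring
    _ = _ := by rw [E2, E4, E5]

/-- **Value form of W35**: `2 · B(⅚,½) = √3 · B(⅔,½)` (equivalently `2B(½,⅚) = √3 B(½,⅔)`,
`B(⅚,½) = 2.2405…`). [Andrews–Askey–Roy 1999, §1.1; this work] -/
theorem soloInformed_secondKind_W35_value (B₅₃ B₄₃ : IntegralRep 1)
    (h53d : B₅₃.domain = {t | t 0 ∈ Ioo (0:ℝ) 1})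
    (h53i : EqOn B₅₃.integrand
      (fun t => (t 0) ^ (((5 / 6 : ℚ) : ℝ) - 1) * (1 - t 0) ^ (((1 / 2 : ℚ) : ℝ) - 1)) B₅₃.domain)
    (h43d : B₄₃.domain = {t | t 0 ∈ Ioo (0:ℝ) 1})
    (h43i : EqOn B₄₃.integrand
      (fun t => (t 0) ^ (((2 / 3 : ℚ) : ℝ) - 1) * (1 - t 0) ^ (((1 / 2 : ℚ) : ℝ) - 1)) B₄₃.domain) :
    2 * B₅₃.value = Real.sqrt 3 * B₄₃.value := by
  have h := congr_arg evalP (soloInformed_secondKind_W35 B₅₃ B₄₃ h53d h53i h43d h43i)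
  simpa only [map_mul, map_ofNat, evalP_toFormalPeriod_of, IntegralRep.value_constMul,
    IntegralRep.value_unit, mul_one] using h

/-- **`⟦β(⅚,½)⟧` lies in the `K`-hull of any family whose hull contains `⟦β(⅔,½)⟧`**
(`⟦[pt,9√3]⟧, ⟦[pt,1/18]⟧ ∈ K`). [this work] -/
theorem soloInformed_betaFiveSixthsHalf_mem_algHull (B₅₃ B₄₃ : IntegralRep 1)
    (h53d : B₅₃.domain = {t | t 0 ∈ Ioo (0:ℝ) 1})
    (h53i : EqOn B₅₃.integrand
      (fun t => (t 0) ^ (((5 / 6 : ℚ) : ℝ) - 1) * (1 - t 0) ^ (((1 / 2 : ℚ) : ℝ) - 1)) B₅₃.domain)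
    (h43d : B₄₃.domain = {t | t 0 ∈ Ioo (0:ℝ) 1})
    (h43i : EqOn B₄₃.integrand
      (fun t => (t 0) ^ (((2 / 3 : ℚ) : ℝ) - 1) * (1 - t 0) ^ (((1 / 2 : ℚ) : ℝ) - 1)) B₄₃.domain)
    {k : ℕ} (cs : Fin k → FormalPeriodRing)
    (hB : toFormalPeriod (of B₄₃) ∈ soloInformedAlgHull cs) :
    toFormalPeriod (of B₅₃) ∈ soloInformedAlgHull cs := by
  have hca : IsAlgebraic ℚ ((((1 / 18 : ℚ)) : ℝ)) := isAlgebraic_algebraMap (1 / 18 : ℚ)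
  rw [← soloInformed_secondKind_isogeny_chain hca B₄₃ B₅₃ h43d h43i h53d h53i]
  exact mul_mem (soloInformed_pointRep_mem_algHull cs _ _)
    (mul_mem (soloInformed_pointRep_mem_algHull cs _ hca) hB)

/-- **`⟦β(⅚,⅚)⟧` lies in the `K`-hull of any family whose hull contains `⟦β(⅔,½)⟧`**: the
duplication move at `a = ⅚` (`⟦[pt,4^{5/6}]⟧·⟦β(⅚,⅚)⟧ = 2⟦β(⅚,½)⟧`) on top of W35 — so the
sixth "rigid" class `x(5,5)` of paper §6octies (vi) is decided relative to `x(4,3)` too.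
[this work] -/
theorem soloInformed_betaFiveSixthsFiveSixths_mem_algHull (B₅₅ B₄₃ : IntegralRep 1)
    (h55d : B₅₅.domain = {t | t 0 ∈ Ioo (0:ℝ) 1})
    (h55i : EqOn B₅₅.integrand
      (fun t => (t 0) ^ (((5 / 6 : ℚ) : ℝ) - 1) * (1 - t 0) ^ (((5 / 6 : ℚ) : ℝ) - 1)) B₅₅.domain)
    (h43d : B₄₃.domain = {t | t 0 ∈ Ioo (0:ℝ) 1})
    (h43i : EqOn B₄₃.integrand
      (fun t => (t 0) ^ (((2 / 3 : ℚ) : ℝ) - 1) * (1 - t 0) ^ (((1 / 2 : ℚ) : ℝ) - 1)) B₄₃.domain)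
    {k : ℕ} (cs : Fin k → FormalPeriodRing)
    (hB : toFormalPeriod (of B₄₃) ∈ soloInformedAlgHull cs) :
    toFormalPeriod (of B₅₅) ∈ soloInformedAlgHull cs := by
  obtain ⟨B₅₃, h53d, h53i⟩ := exists_betaRep' (5 / 6) (1 / 2) (by norm_num) (by norm_num)
  exact soloInformed_betaSymm_mem_algHull (5 / 6) B₅₅ B₅₃ h55d h55i h53d (fun x _ => by rw [h53i])
    cs (soloInformed_betaFiveSixthsHalf_mem_algHull B₅₃ B₄₃ h53d (fun x _ => by rw [h53i]) h43d
      h43i cs hB)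

end Summit.KontsevichZagierPeriods.KontsevichZagierPeriods.Theorems

end
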